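import Summits.HodgeConjecture.HodgeConjecture.Theorems.Ring2BindersAbelianSchemeVHCShadow
import Literature.AlgebraicGeometry.Motives.ConstantFamilyFibre
import Literature.AlgebraicGeometry.Motives.SmoothProjectiveFamilyOverOpen
import Literature.AlgebraicGeometry.Motives.AbelianVarietyProductDimProofs
import Literature.AlgebraicGeometry.Motives.AlgPointsNonempty
import Literature.AlgebraicGeometry.HodgeTheory.AlgebraicClassesFibreRestriction
import Literature.AlgebraicGeometry.HodgeTheory.MotivatedClassesAlgebraic
import Literature.AlgebraicGeometry.HodgeTheory.HodgeTypeExteriorProduct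
import Literature.AlgebraicGeometry.HodgeTheory.AlgebraicClassesPullbackDimLEThree
import HarnessLib

/-!
# Ring 2 — binder seat b02 (Hodge ladder stage 3): the MIDDLE LIFT of a global class below the middle degree —
# the product padding `𝒳 ↦ 𝒳 × B`, `W ↦ pr_𝒳^*(Kʳ ∪ W)` for row b02 `AbelianSchemeVHC`, fact-free on quasi-projective carriers

HONEST FRAMING: research route conditional on HC_CM; not a corollary; Q11.4-sentence-2 already refuted in dim ≥ 3.

Cell `pub-hodge-ring2`, binder seat `ring2-b02`, row b02 of `BINDER-OWNERS.md` (`Ring2.Hypotheses.AbelianSchemeVHC`: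
Grothendieck's variational Hodge conjecture, global-class form, along smooth projective families all of whose complex
fibres are abelian varieties; OPEN, print-equivalent to `HC_AV`). `HC_CM` (`Theses.RankFourFaces.CMAbelianHodge`) does
not occur below; nothing here is a case of the Hodge conjecture; no `sorry`, no definition, no named fact, no node.

WHAT THIS PART DOES. The shadow / halving parts (`Ring2BindersAbelianSchemeVHCShadow.lean` p246125,
`Ring2BindersAbelianSchemeVHCHalving.lean` p246317) reduced row b02 to its LOWER HALF `2p ≤ n` modulo the print residual:
a two-parameter family of cells `(n, p)`, `n ≥ 4`, `2 ≤ p ≤ n/2`. The sequel `Ring2BindersAbelianSchemeVHCMiddleDegree.lean`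
collapses it to the DIAGONAL `(2q, q)` — the middle degree of the families of EVEN relative dimension, the variational
analogue of the sub-cell AbelianAll's `HC_AV_iff_forall_middleDegree` (part XV; BFNP Lemma 48 run inside abelian
varieties). This file is its engine, on the carriers with QUASI-PROJECTIVE total space, where the tree holds ONE global
degree-2 class `K` polarising every fibre (shadow part §1). The padding is by a CONSTANT abelian factor `B` of dimension
`r = n - 2p`; no Gysin map, no Künneth formula and no moving lemma is needed, only pull-backs:

* §1 the product family: `exists_fiberOver_fst_comp_iso` (`(𝒳 × B)_s ≅ 𝒳_s × B` compatibly with the inclusions —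
  pasting of the cartesian squares `SectionFamily.isPullback_fst_whiskerRight` and `familyPullback.isPullback`),
  `isSmoothProjectiveFamily_fst_comp` (`pr_𝒳 ≫ f : 𝒳 × B ⟶ S` is a smooth projective family of relative dimension
  `n + r`: base change, composition, Segre), `exists_abelianVariety_iso_fiberOver_fst_comp` (fibres `A' × B`).
* §2 `mem_algebraicClasses_of_map_fst_mem` — **`pr_X^* x` algebraic on `X × B` ⟹ `x` algebraic on `X`**: restrict to
  the fibre `X × {t} ≅ X` of the CONSTANT family `X × B ⟶ B` over the smooth irreducible projective base `B`, using the
  tree's PROVED restriction of algebraic classes to the fibres of a smooth projective family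
  (`map_fiberι_mem_algebraicClasses`: specialisation of cycles, Fulton §10.1 / Charles–Schnell Prop. 11.3.11, NOT the
  named fact `fulton1998_map_mem_algebraicClasses`) and the slice `sliceFiberIso`.
* §3 **THE MIDDLE LIFT** `exists_middleLift`: for `2p + dim B = n` and `W ∈ H²ᵖ(𝒳(ℂ); ℂ)` fibrewise rational `(p,p)`,
  the class `W♯ := pr_𝒳^*(Kʳ ∪ W) ∈ H^{2(p+r)}((𝒳 × B)(ℂ); ℂ)` is fibrewise rational of type `(p + r, p + r)` — the
  MIDDLE degree of `𝒳 × B ⟶ S` — and `W♯|_{(𝒳 × B)_s}` is algebraic ⟺ `W|_{𝒳_s}` is algebraic, for EVERY `s`: the two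
  algebraicity loci COINCIDE (`⟸`: `Lʳ` and the flat `pr^*` move algebraic classes; `⟹`: §2, then `A(𝒳_s, K|_{𝒳_s})`
  — Lieberman's `B(A)` — descends `Lʳ`, the shadow part's `mem_algebraicClasses_of_lefschetzPowTo_mem`).

Everything is FACT-FREE (closures: the three standard axioms). What is NOT claimed: any case of `AbelianSchemeVHC` or of
HC; anything about `HC_CM`; anything for carriers whose total space is not quasi-projective (the print residual N96/N97,
Raynaud 1970 — see the sequel); primitivity of the lift for the product polarisation (false in general, not needed).

References: [BrosnanFangNiePearlstein2009] §6 Lemma 48; [VoisinHodgeI2002] Thm. 6.25, Rem. 6.27, §7.1.2, §7.3.2,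
Thm. 11.30; [VoisinHodgeII2003] Thm. 4.18, §9.2.4 Prop. 9.20; [Fulton1998] §10.1 Cor. 10.1, Example 10.1.2, §19.2
Cor. 19.2 (b); [CharlesSchnell2014Notes] Conj. 11.3.1, Prop. 11.3.11 (proof); [KerrPearlstein2011] §3.1; [Lieberman1968]
main theorem; [Kleiman1968AlgebraicCycles] §2, Thm. 2A11; [Grothendieck1968] §3 p. 196; [Hartshorne1977] II.3 p. 89,
II Ex. 4.9, III Prop. 10.1; [MumfordAV1970] §1; [SerreGAGA1956] §2 n°5.
-/

-- every declaration of this problem lives in `Summit.HodgeConjecture.HodgeConjecture.…` (summit = sub-problem);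
-- namespace `…Ring2.Binders` = the binder seats of the cell's Hodge-ladder stage 3 (`BINDER-OWNERS.md`)
set_option linter.dupNamespace false

noncomputable section

open CategoryTheory CategoryTheory.Limits AlgebraicGeometry Topology MonoidalCategory CartesianMonoidalCategory
open Literature.AlgebraicGeometry Literature.AlgebraicGeometry.Motives
open Literature.AlgebraicGeometry.HodgeTheory

namespace Summit.HodgeConjecture.HodgeConjecture.Ring2.Binders


variable {𝒳 S : SchemeOver ℂ}

/-! ## §1 The product family `𝒳 × B ⟶ S` with a constant smooth projective factor -/

/-- **`(𝒳 × B)_s ≅ 𝒳_s × B`, compatibly with the inclusions into `𝒳 × B`.** The square `𝒳_s × B ⟶ 𝒳 × B` (`ι_s ▷ B`),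
`pr : 𝒳_s × B ⟶ 𝒳_s`, `pr : 𝒳 × B ⟶ 𝒳`, `ι_s` is cartesian (`SectionFamily.isPullback_fst_whiskerRight`), the fibre
square of `f` at `s` is cartesian; pasted vertically they present `𝒳_s × B` as the fibre of `pr ≫ f` over `s`
(Hartshorne II.3, transitivity of base change). [cite: Hartshorne1977, II.3 (p. 89) and III Prop. 10.1 (b)] -/
theorem exists_fiberOver_fst_comp_iso (f : 𝒳 ⟶ S) (B : SchemeOver ℂ) (s : ComplexPoints S) :
    ∃ e : fiberOver f s ⊗ B ≅ fiberOver (fst 𝒳 B ≫ f) s, e.hom ≫ fiberι (fst 𝒳 B ≫ f) s = fiberι f s ▷ B := by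
  have hbot : IsPullback (fiberι f s) (fiberOverToSpec f s) f s := familyPullback.isPullback f s
  have htop : IsPullback (fiberι f s ▷ B) (fst (fiberOver f s) B) (fst 𝒳 B) (fiberι f s) :=
    (SectionFamily.isPullback_fst_whiskerRight (fiberι f s) B).flip
  have hbig := htop.paste_vert hbot
  exact ⟨IsPullback.isoIsPullback _ _ hbig (familyPullback.isPullback (fst 𝒳 B ≫ f) s),
    IsPullback.isoIsPullback_hom_fst _ _ _ _⟩

/-- **The product of a smooth projective family with a constant smooth projective factor is a smooth projective
family**: for `f : 𝒳 ⟶ S` smooth projective of relative dimension `n` and `B` smooth projective of dimension `r`,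
`pr_𝒳 ≫ f : 𝒳 × B ⟶ S` is smooth of relative dimension `n + r` (base change and composition, Hartshorne III Prop. 10.1
(b)–(c)), proper, and its fibre over `s` is `𝒳_s × B` (`exists_fiberOver_fst_comp_iso`), smooth projective of
dimension `n + r` (Segre, `IsSmoothProjective.tensor_holds`). [cite: Hartshorne1977, III Prop. 10.1 (b)–(d) and II Ex. 4.9] -/
theorem isSmoothProjectiveFamily_fst_comp (f : 𝒳 ⟶ S) {n r : ℕ} (hf : IsSmoothProjectiveFamily f n)
    {B : SchemeOver ℂ} (hB : IsSmoothProjective r B) : IsSmoothProjectiveFamily (fst 𝒳 B ≫ f) (n + r) := by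
  haveI : IsProper f.left := hf.isProper
  haveI : IsProper B.hom := IsSmoothProjective.isProper_holds hB
  haveI := hf.smoothOfRelativeDimension
  refine ⟨?_, ?_, fun s ↦ ?_⟩
  · change SmoothOfRelativeDimension (n + r) (pullback.fst 𝒳.hom B.hom ≫ f.left)
    haveI := smoothOfRelativeDimension_isStableUnderBaseChange (n := r)
    haveI : SmoothOfRelativeDimension r (pullback.fst 𝒳.hom B.hom) :=
      MorphismProperty.pullback_fst (P := @SmoothOfRelativeDimension r) _ _ hB.smoothOfRelativeDimension
    rw [Nat.add_comm]
    infer_instance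
  · change IsProper (pullback.fst 𝒳.hom B.hom ≫ f.left)
    infer_instance
  · obtain ⟨e, -⟩ := exists_fiberOver_fst_comp_iso f B s
    exact (IsSmoothProjective.tensor_holds (hf.isSmoothProjective s) hB).of_iso e

/-- **The fibres of `𝒳 × B ⟶ S` are abelian varieties** when those of `f` are and `B` is one: `(𝒳 × B)_s ≅ 𝒳_s × B ≅
A' × B` (`AbelianVariety.prod`, `dim (A' × B) = dim A' + dim B`). [cite: Hartshorne1977, II.3 (p. 89)]
[cite: MumfordAV1970, §1 (products of abelian varieties)] -/
theorem exists_abelianVariety_iso_fiberOver_fst_comp (f : 𝒳 ⟶ S) {n : ℕ}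
    (hA : ∀ s : ComplexPoints S, ∃ A' : AbelianVariety ℂ, A'.dim = n ∧ Nonempty (A'.X ≅ fiberOver f s))
    (B : AbelianVariety ℂ) (s : ComplexPoints S) :
    ∃ A'' : AbelianVariety ℂ, A''.dim = n + B.dim ∧ Nonempty (A''.X ≅ fiberOver (fst 𝒳 B.X ≫ f) s) := by
  obtain ⟨A', hA', ⟨eA⟩⟩ := hA s
  obtain ⟨e, -⟩ := exists_fiberOver_fst_comp_iso f B.X s
  exact ⟨A'.prod B, by rw [AbelianVariety.dim_prod, hA'], ⟨whiskerRightIso eA B.X ≪≫ e⟩⟩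

/-! ## §2 `pr_X^* x` algebraic on `X × B` forces `x` algebraic on `X` (restriction to a slice; no moving lemma) -/

/-- **Descent of algebraicity along the projection of a product with an abelian variety.** For `X` smooth projective
of dimension `n`, `B` a complex abelian variety and `x ∈ H^{2q}(X(ℂ); ℂ)`: if `pr_X^* x` is algebraic on `X × B` then `x`
is algebraic on `X`. Proof: `X × B ⟶ B` is a smooth projective (constant) family over the smooth irreducible projective
`B` (`isSmoothProjectiveFamily_snd`); restriction of algebraic classes to its fibre over a point `t ∈ B(ℂ)` is the tree's
PROVED `map_fiberι_mem_algebraicClasses` (specialisation of cycles, Fulton §10.1 / Charles–Schnell Prop. 11.3.11); that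
fibre is `X` by the slice `X ≅ (X × B)_t`, along which `pr_X^* x` restricts to `x` (`sliceFiberIso_hom_fiberι_fst`).
[cite: Fulton1998, §10.1 Cor. 10.1, Example 10.1.2 and §19.2 Cor. 19.2 (b)] [cite: CharlesSchnell2014Notes, Prop. 11.3.11 (proof)]
[cite: Hartshorne1977, II.3 (p. 89)] -/
theorem mem_algebraicClasses_of_map_fst_mem {X : SchemeOver ℂ} {n : ℕ} (hX : IsSmoothProjective n X)
    (B : AbelianVariety ℂ) {q : ℕ} {x : complexBetti X (2 * q)}
    (h : complexBetti.map (fst X B.X) (2 * q) x ∈ algebraicClasses (X ⊗ B.X) q) : x ∈ algebraicClasses X q := by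
  have hB : IsSmoothProjective B.dim B.X := AbelianVariety.isSmoothProjective_holds
  haveI : IrreducibleSpace B.X.left := hB.irreducibleSpace
  haveI := hB.smoothOfRelativeDimension
  haveI : AlgebraicGeometry.Smooth B.X.hom := SmoothOfRelativeDimension.smooth B.dim B.X.hom
  obtain ⟨t⟩ := hB.nonempty_algPoints ℂ
  have h₁ := map_fiberι_mem_algebraicClasses (snd X B.X) (isSmoothProjectiveFamily_snd hX B.X)
    (IsQuasiProjectiveOver.of_isProjectiveOver hB.isProjectiveOver) h t
  have h₂ := map_mem_algebraicClasses_of_isIso (sliceFiberIso X t).hom h₁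
  rw [← CategoryTheory.comp_apply, ← complexBetti.map_comp, ← CategoryTheory.comp_apply, ← complexBetti.map_comp,
    Category.assoc, sliceFiberIso_hom_fiberι_fst, complexBetti.map_id] at h₂
  exact h₂

/-! ## §3 The middle lift of a global class below the middle -/

/-- **THE MIDDLE LIFT.** Let `f : 𝒳 ⟶ S` be a smooth projective family of relative dimension `n = 2p + dim B` with
quasi-projective total space over a separated `S`, all complex fibres abelian varieties, `B` a complex abelian variety,
and `W ∈ H²ᵖ(𝒳(ℂ); ℂ)` fibrewise rational of type `(p, p)`. Then `pr_𝒳 ≫ f : 𝒳 × B ⟶ S` is a smooth projective family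
of relative dimension `n + dim B = 2(p + dim B)` with abelian fibres (§1), and `W♯ := pr_𝒳^*(Kʳ ∪ W)` (`K` the global
polarising class of the shadow part, `r = dim B`) is fibrewise rational of type `(p + r, p + r)` — the MIDDLE of the new
family — with `W♯|_{(𝒳 × B)_s}` algebraic iff `W|_{𝒳_s}` algebraic, for EVERY `s`. On the fibre, `W♯| = e^*pr^*(Lʳ_{K|}
W|)` (`map_lefschetzPowTo`; `e : (𝒳 × B)_s ≅ 𝒳_s × B`): rational (`IsRationalClass.lefschetzPowTo`, `.map`), of type
`(p+r, p+r)` (`HardLefschetzNFold.isOfHodgeType_L`, pull-backs preserve Hodge types `IsOfHodgeType.map_of_isSmoothProjective`);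
`⟸`: `Lʳ` and the flat `pr^*` move algebraic classes (`L_mem_algebraicClasses_of_mem`, `map_fst_mem_supportedClasses`);
`⟹`: §2, then `A(𝒳_s, K|_{𝒳_s})` from Lieberman's `B(A)` descends `Lʳ` (`mem_algebraicClasses_of_lefschetzPowTo_mem`,
`standardConjectureA_of_iso_abelianVariety`). FACT-FREE. [cite: BrosnanFangNiePearlstein2009, §6 Lemma 48]
[cite: VoisinHodgeI2002, Thm. 6.25, Rem. 6.27, §7.1.2 and §7.3.2] [cite: VoisinHodgeII2003, §9.2.4 Prop. 9.20]
[cite: Lieberman1968, main theorem] [cite: Fulton1998, §10.1 Cor. 10.1] -/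
theorem exists_middleLift (f : 𝒳 ⟶ S) {n : ℕ} (hf : IsSmoothProjectiveFamily f n) (h𝒳 : IsQuasiProjectiveOver 𝒳)
    [IsSeparated S.hom]
    (hA : ∀ s : ComplexPoints S, ∃ A' : AbelianVariety ℂ, A'.dim = n ∧ Nonempty (A'.X ≅ fiberOver f s))
    (B : AbelianVariety ℂ) {p : ℕ} (hp : 2 * p + B.dim = n) (W : complexBetti 𝒳 (2 * p))
    (hW : ∀ s : ComplexPoints S, IsRationalClass (complexBetti.map (fiberι f s) (2 * p) W) ∧
      IsOfHodgeType n (fiberOver f s) (2 * p) p p (complexBetti.map (fiberι f s) (2 * p) W)) :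
    IsSmoothProjectiveFamily (fst 𝒳 B.X ≫ f) (n + B.dim) ∧
    (∀ s : ComplexPoints S, ∃ A'' : AbelianVariety ℂ, A''.dim = n + B.dim ∧
      Nonempty (A''.X ≅ fiberOver (fst 𝒳 B.X ≫ f) s)) ∧
    ∃ W' : complexBetti (𝒳 ⊗ B.X) (2 * (p + B.dim)),
      (∀ s : ComplexPoints S, IsRationalClass (complexBetti.map (fiberι (fst 𝒳 B.X ≫ f) s) (2 * (p + B.dim)) W') ∧
        IsOfHodgeType (n + B.dim) (fiberOver (fst 𝒳 B.X ≫ f) s) (2 * (p + B.dim)) (p + B.dim) (p + B.dim)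
          (complexBetti.map (fiberι (fst 𝒳 B.X ≫ f) s) (2 * (p + B.dim)) W')) ∧
      ∀ s : ComplexPoints S,
        complexBetti.map (fiberι (fst 𝒳 B.X ≫ f) s) (2 * (p + B.dim)) W' ∈
            algebraicClasses (fiberOver (fst 𝒳 B.X ≫ f) s) (p + B.dim) ↔
          complexBetti.map (fiberι f s) (2 * p) W ∈ algebraicClasses (fiberOver f s) p := by
  have hB : IsSmoothProjective B.dim B.X := AbelianVariety.isSmoothProjective_holds
  have hm : 2 * p + 2 * B.dim = 2 * (p + B.dim) := by omega
  refine ⟨isSmoothProjectiveFamily_fst_comp f hf hB, exists_abelianVariety_iso_fiberOver_fst_comp f hA B, ?_⟩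
  -- (i) the global polarising class and its hard Lefschetz data on the fibres
  obtain ⟨K, hK⟩ := exists_forall_isPolarizationClass_map_fiberι f hf h𝒳
  choose Λ hΛ using fun s ↦ (hK s).exists_hardLefschetzNFold (hf.isSmoothProjective s)
  -- (ii) the restriction of `W♯ = pr^*(Lʳ_K W)` to the fibre over `s`, read on `𝒳_s × B` through `e : 𝒳_s × B ≅ (𝒳 × B)_s`
  have key : ∀ s : ComplexPoints S, ∃ e : fiberOver f s ⊗ B.X ≅ fiberOver (fst 𝒳 B.X ≫ f) s,
      complexBetti.map (fiberι (fst 𝒳 B.X ≫ f) s) (2 * (p + B.dim))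
          (complexBetti.map (fst 𝒳 B.X) (2 * (p + B.dim)) (lefschetzPowTo K B.dim (2 * p) (2 * (p + B.dim)) hm W)) =
        complexBetti.map e.inv (2 * (p + B.dim)) (complexBetti.map (fst (fiberOver f s) B.X) (2 * (p + B.dim))
          (lefschetzPowTo (complexBetti.map (fiberι f s) 2 K) B.dim (2 * p) (2 * (p + B.dim)) hm
            (complexBetti.map (fiberι f s) (2 * p) W))) := fun s ↦ by
    obtain ⟨e, he⟩ := exists_fiberOver_fst_comp_iso f B.X s
    refine ⟨e, ?_⟩
    have hι' : fiberι (fst 𝒳 B.X ≫ f) s = e.inv ≫ fiberι f s ▷ B.X := e.eq_inv_comp.2 he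
    have hι : fiberι (fst 𝒳 B.X ≫ f) s ≫ fst 𝒳 B.X = e.inv ≫ fst (fiberOver f s) B.X ≫ fiberι f s := by
      rw [hι', Category.assoc, whiskerRight_fst]
    calc complexBetti.map (fiberι (fst 𝒳 B.X ≫ f) s) (2 * (p + B.dim))
          (complexBetti.map (fst 𝒳 B.X) (2 * (p + B.dim)) (lefschetzPowTo K B.dim (2 * p) (2 * (p + B.dim)) hm W))
        = complexBetti.map (fiberι (fst 𝒳 B.X ≫ f) s ≫ fst 𝒳 B.X) (2 * (p + B.dim))
            (lefschetzPowTo K B.dim (2 * p) (2 * (p + B.dim)) hm W) := (complexBetti.map_comp_apply' _ _ _ _).symm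
      _ = complexBetti.map (e.inv ≫ fst (fiberOver f s) B.X ≫ fiberι f s) (2 * (p + B.dim))
            (lefschetzPowTo K B.dim (2 * p) (2 * (p + B.dim)) hm W) := by rw [hι]
      _ = complexBetti.map e.inv (2 * (p + B.dim)) (complexBetti.map (fst (fiberOver f s) B.X) (2 * (p + B.dim))
            (complexBetti.map (fiberι f s) (2 * (p + B.dim)) (lefschetzPowTo K B.dim (2 * p) (2 * (p + B.dim)) hm W))) := by
          rw [complexBetti.map_comp_apply', complexBetti.map_comp_apply']
      _ = _ := by rw [map_lefschetzPowTo]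
  refine ⟨complexBetti.map (fst 𝒳 B.X) (2 * (p + B.dim)) (lefschetzPowTo K B.dim (2 * p) (2 * (p + B.dim)) hm W),
    fun s ↦ ?_, fun s ↦ ?_⟩
  · -- fibrewise rational of type `(p + r, p + r)`
    obtain ⟨e, he⟩ := key s
    have hx : IsOfHodgeType n (fiberOver f s) (2 * (p + B.dim)) (p + B.dim) (p + B.dim)
        (lefschetzPowTo (complexBetti.map (fiberι f s) 2 K) B.dim (2 * p) (2 * (p + B.dim)) hm
          (complexBetti.map (fiberι f s) (2 * p) W)) := by
      rw [← hΛ s]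
      exact (Λ s).isOfHodgeType_L B.dim (2 * p) (2 * (p + B.dim)) hm p p (hW s).2
    rw [he]
    exact ⟨(((hK s).isRationalClass.lefschetzPowTo B.dim (2 * p) (2 * (p + B.dim)) hm (hW s).1).map _).map _,
      (isOfHodgeType_map_iff_of_iso e.symm).2 (hx.map_of_isSmoothProjective
        (IsSmoothProjective.tensor_holds (hf.isSmoothProjective s) hB) (hf.isSmoothProjective s)
        (fst (fiberOver f s) B.X))⟩
  · -- the two algebraicity loci coincide
    obtain ⟨e, he⟩ := key s
    rw [he]
    refine ⟨fun h ↦ ?_, fun h ↦ ?_⟩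
    · -- `⟹`: undo the iso, descend the slice (§2), descend `Lʳ` by `A(𝒳_s, K|_{𝒳_s})` (Lieberman)
      have h₁ := (mem_algebraicClasses_map_iff_of_iso e.symm).1 h
      have h₂ := mem_algebraicClasses_of_map_fst_mem (hf.isSmoothProjective s) B h₁
      obtain ⟨A', hA'dim, ⟨eA⟩⟩ := hA s
      exact mem_algebraicClasses_of_lefschetzPowTo_mem
        (standardConjectureA_of_iso_abelianVariety (hf.isSmoothProjective s) hA'dim eA (hK s)) hp hm rfl _ h₂
    · -- `⟸`: `Lʳ` moves algebraic classes, then the flat pull-back `pr^*`, then the iso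
      have h₁ : lefschetzPowTo (complexBetti.map (fiberι f s) 2 K) B.dim (2 * p) (2 * (p + B.dim)) hm
          (complexBetti.map (fiberι f s) (2 * p) W) ∈ algebraicClasses (fiberOver f s) (p + B.dim) := by
        rw [← hΛ s]
        exact (Λ s).L_mem_algebraicClasses_of_mem B.dim p hm h
      exact map_mem_algebraicClasses_of_isIso e.inv
        (map_fst_mem_supportedClasses (hf.isSmoothProjective s) hB h₁)

/-! ## Audit: fact-free (closures are the three standard axioms; no named fact, no `HC_CM`) -/

#print axioms Summit.HodgeConjecture.HodgeConjecture.Ring2.Binders.isSmoothProjectiveFamily_fst_comp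
#print axioms Summit.HodgeConjecture.HodgeConjecture.Ring2.Binders.mem_algebraicClasses_of_map_fst_mem
#print axioms Summit.HodgeConjecture.HodgeConjecture.Ring2.Binders.exists_middleLift

end Summit.HodgeConjecture.HodgeConjecture.Ring2.Binders

end
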